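import Summits.Ventures.Crystal3D.Kissing125.SearchCheck1
import HarnessLib

/-!
# The growth search: definitions of the semantics (`KConf`, `Realizes`, …) — K25 copy at `κ = 7/32` (`h = 5/4`), part 1/2

HONEST FRAMING (cell pub-crystal3d, K-path at `h = 5/4`): this is NOT a result printed by Hales.  It is his
METHOD (arXiv:1209.6043, Theorem 3: the main estimate + the classification of the contact graphs of kissing
configurations, in the tree's form of a verified interval-arithmetic growth search, `Literature/…/KissingSearch*.lean`)
RE-RUN at the separation `5/2` instead of `2h₀ = 2.52` (largest long-side cosine `κ = 1 − (5/4)²/2 = 7/32` instead of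
`κ₀ = 1031/5000`).  The declarations are namespace-shadowing COPIES of the tree's declarations (same names, inside
`namespace Summit.Ventures.Crystal3D.Kissing125[.KissingSearch]`, original docstrings and citation tags kept — the tags
name the printed METHOD step each declaration implements); the diff to the originals is stated per file.  Generated by
`HOME/lean/kissing125/gen/mkfiles.py`; audit recipe in `HOME/lean/kissing125/README.md`.  Nothing here is asserted
about GAP(1.26) or any census.

THIS FILE: copy of `Literature/Geometry/DiscreteGeometry/KissingSearchDefs.lean` with NO change except the namespace line (the proofs are generic in the value of `κ0`; they elaborate unchanged at `7/32`).  (Part 1 of 2: lines 1–224 of the transformed copy; the split is only for the 400-line rule.)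

## References
* T. C. Hales, *A proof of Fejes Tóth's conjecture on sphere packings with kissing number twelve*,
  arXiv:1209.6043 (2012): Definition 1, Theorem 2 (main estimate `d₃`), Theorem 3, Lemmas 7–10. [`Hales2012`]
* R. E. Moore, *Interval Analysis* (1966), Theorem 3.1, §4.4. [`Moore1966`]
-/

namespace Summit.Ventures.Crystal3D.Kissing125

open Literature.Geometry.DiscreteGeometry

namespace KissingSearch

open Real Literature.Analysis.ValidatedNumerics KissingLP NonemptyInterval Finset

/-! ### Part A. Numeric semantics -/

/-- **The enclosure relation**: the bracket `br` is feasible and `θ ∈ [brLo br · δ, brHi br · δ]`.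
[folklore] -/
def Encl (br : ℕ) (θ : ℝ) : Prop :=
  br ≠ NOBR ∧ ((brLo br : ℝ) * δ ≤ θ ∧ θ ≤ (brHi br : ℝ) * δ)

/-- Membership of a real in the cell of a symbol. [folklore] -/
def SymMem (σ : ℕ) (x : ℝ) : Prop := x ∈ (symIv σ).ratCast ℝ

/-- The circumradius polynomial as a real function. [folklore] -/
def Pfun (x y z : ℝ) : ℝ :=
  1 + 8 * x * y * z - 3 * (x ^ 2 + y ^ 2 + z ^ 2) + 2 * (x + y + z) - 2 * (x * y + x * z + y * z)

/-- The point of `ℕ → ℝ` carrying `(x, y, z)` in the coordinates `0, 1, 2` (and `z` beyond).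
[folklore] -/
def pt3 (x y z : ℝ) : ℕ → ℝ := fun i => if i = 0 then x else if i = 1 then y else z

/-- The symbols of a domain code, as a list. [folklore] -/
def symsList (r : ℕ) : List ℕ := if r = 0 then [0] else List.range' (rLo r) (rHi r + 1 - rLo r)

/-- A VALID domain code: the contact code `0`, or a cell range `1 ≤ lo ≤ hi ≤ K` in normal
form. [folklore] -/
def ValidDom (r : ℕ) : Prop := r = 0 ∨ (1 ≤ rLo r ∧ rLo r ≤ rHi r ∧ rHi r ≤ K ∧ r = mkR (rLo r) (rHi r))

/-! ### Part B. The abstract structure, its conclusion, codes, semantics, realized states -/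

/-- `κ₀` as a real number. [cite: Hales2012, Definition 1] -/
noncomputable def κ0R : ℝ := ((κ0 : ℚ) : ℝ)

/-- **The local structure of a labelled fan triangulation of a kissing configuration.**  Labels
are natural numbers `< 12`; `g a b` is the inner product of the unit vectors with labels `a, b`;
`T` is the set of fan triangles (three-element sets of labels); `ang t v` is the angle of the
triangle `t` at its vertex `v` (`0` if `v ∉ t`).  The fields after `ang` are the axioms used by
the search; all of them are proved for kissing configurations in `KissingSearchGeometry.lean`.
[cite: Hales2012, Definition 1 and proof of Theorem 3] -/
structure KConf where
  /-- Gram entries -/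
  g : ℕ → ℕ → ℝ
  /-- fan triangles -/
  T : Finset (Finset ℕ)
  /-- angle of a triangle at a vertex -/
  ang : Finset ℕ → ℕ → ℝ
  /-- symmetry of the Gram entries -/
  g_symm : ∀ a b, g a b = g b a
  /-- triangles are three labels `< 12` -/
  mem_T : ∀ t ∈ T, t.card = 3 ∧ ∀ a ∈ t, a < 12
  /-- twenty triangles -/
  card_T : T.card = 20
  /-- every side of a triangle lies in exactly two triangles -/
  two : ∀ t ∈ T, ∀ a ∈ t, ∀ b ∈ t, a ≠ b → (T.filter fun t' => a ∈ t' ∧ b ∈ t').card = 2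
  /-- contacts are sides -/
  contact_side : ∀ a b, a < 12 → b < 12 → a ≠ b → g a b = 1 / 2 → ∃ t ∈ T, a ∈ t ∧ b ∈ t
  /-- the gap: a pair is a contact or has inner product `≤ κ₀` (and `≥ -1`) -/
  dichot : ∀ a b, a < 12 → b < 12 → a ≠ b → g a b = 1 / 2 ∨ (-1 ≤ g a b ∧ g a b ≤ κ0R)
  /-- sides of triangles have inner product `> -1/2` -/
  side_bound : ∀ t ∈ T, ∀ a ∈ t, ∀ b ∈ t, a ≠ b → -(1 / 2 : ℝ) < g a b
  /-- at most four contacts at a label -/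
  cdeg_le : ∀ a, a < 12 → ((range 12).filter fun b => b ≠ a ∧ g a b = 1 / 2).card ≤ 4
  /-- at least `23` contact pairs -/
  contacts_ge : 23 ≤ (((range 12) ×ˢ (range 12)).filter fun p => p.1 < p.2 ∧ g p.1 p.2 = 1 / 2).card
  /-- node equation -/
  node : ∀ v, v < 12 → ∑ t ∈ T, ang t v = 2 * π
  /-- angles are nonnegative -/
  ang_nonneg : ∀ t v, 0 ≤ ang t v
  /-- angles are at most `π` -/
  ang_le_pi : ∀ t v, ang t v ≤ π
  /-- the angle of a triangle at a non-vertex is `0` -/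
  ang_zero : ∀ t ∈ T, ∀ v, v ∉ t → ang t v = 0
  /-- spherical law of cosines -/
  cos_law : ∀ t ∈ T, ∀ v ∈ t, ∀ a ∈ t, ∀ b ∈ t, v ≠ a → v ≠ b → a ≠ b →
    Real.cos (ang t v) * (Real.sqrt (1 - g v a ^ 2) * Real.sqrt (1 - g v b ^ 2)) = g a b - g v a * g v b
  /-- circumradius `< 60°` in polynomial form -/
  circum : ∀ t ∈ T, ∀ v ∈ t, ∀ a ∈ t, ∀ b ∈ t, v ≠ a → v ≠ b → a ≠ b → 0 < Pfun (g v a) (g v b) (g a b)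
  /-- the rhombus cap -/
  pairing : ∀ p q v w, p ≠ q → v ≠ w → ({p, q, v} : Finset ℕ) ∈ T → ({p, q, w} : Finset ℕ) ∈ T →
    g v p = 1 / 2 → g v q = 1 / 2 → g w p = 1 / 2 → g w q = 1 / 2 → 0 ≤ g p q
  /-- the link of a label is a single cycle (closure form) -/
  link : ∀ v, v < 12 → ∀ A ⊆ T.filter (fun t => v ∈ t), A.Nonempty →
    (∀ t ∈ A, ∀ t' ∈ T, v ∈ t' → (t ∩ t').card = 2 → t' ∈ A) → A = T.filter fun t => v ∈ t
  /-- the triangles connect the labels -/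
  conn : ∀ D ⊆ range 12, D.Nonempty → (∀ t ∈ T, (∃ a ∈ t, a ∈ D) → t ⊆ D) → D = range 12
  /-- every label is a vertex of a triangle -/
  cover : ∀ v, v < 12 → ∃ t ∈ T, v ∈ t

/-- **The conclusion**: the contact graph of `M` is, by a bijection of the labels, the FCC
(`tameAdjM 1`) or the HCP (`tameAdjM 0`) contact graph. [cite: Hales2012, Lemma 9] -/
def KConf.Concl (M : KConf) : Prop :=
  ∃ i : Fin 8, (i = 0 ∨ i = 1) ∧ ∃ e : Fin 12 ≃ Fin 12,
    ∀ a b : Fin 12, ((a : ℕ) ≠ b ∧ M.g a b = 1 / 2) ↔ tameAdjM i (e a) (e b) = true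

/-- A VALID triangle code: strictly increasing vertices `< 12`, and the code is their
`triCode`. [folklore] -/
def TriValid (t : ℕ) : Prop := tv0 t < tv1 t ∧ tv1 t < tv2 t ∧ tv2 t < 12 ∧ t = triCode (tv0 t) (tv1 t) (tv2 t)

/-- The vertex set of a triangle code. [folklore] -/
def tset (t : ℕ) : Finset ℕ := {tv0 t, tv1 t, tv2 t}

/-- **Meaning of a domain code** for the Gram entry `x` of its side: unlabelled (no
information), contact (`x = 1/2`), or a valid cell range enclosing `x ≠ 1/2`. [folklore] -/
def DomSem (r : ℕ) (x : ℝ) : Prop :=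
  r = UNL ∨ (r = 0 ∧ x = 1 / 2) ∨
    (ValidDom r ∧ r ≠ 0 ∧ x ≠ 1 / 2 ∧ ((gridPt (rLo r - 1) : ℚ) : ℝ) ≤ x ∧ x ≤ ((gridPt (rHi r) : ℚ) : ℝ))

/-- **A state realized by a structure.**  The placed triangles are valid codes of triangles of
`M` without repetition; the side counts are the true counts; every domain code is valid and
means what it says about the Gram entry; labelled sides are sides of placed triangles and
conversely. [folklore] -/
structure Realizes (M : KConf) (s : St) : Prop where
  /-- the domain array has `144` entries -/
  size_dom : s.dom.size = 144
  /-- the side-count array has `144` entries -/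
  size_sc : s.sc.size = 144
  /-- placed triangles are valid codes -/
  valid : ∀ t ∈ s.tris.toList, TriValid t
  /-- placed triangles are triangles of `M` -/
  mem : ∀ t ∈ s.tris.toList, tset t ∈ M.T
  /-- no repetition -/
  nodup : s.tris.toList.Nodup
  /-- the cached side counts are the true counts -/
  sc_eq : ∀ a b, a < 12 → b < 12 → a ≠ b →
    s.gsc a b = (s.tris.toList.filter fun t => tmem t a && tmem t b).length
  /-- domain codes mean what they say -/
  dom : ∀ a b, a < 12 → b < 12 → a ≠ b → DomSem (s.gdom a b) (M.g a b)
  /-- labelled pairs are sides of placed triangles -/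
  lab_side : ∀ a b, a < 12 → b < 12 → a ≠ b → s.gdom a b ≠ UNL →
    ∃ t ∈ s.tris.toList, a ∈ tset t ∧ b ∈ tset t
  /-- sides of placed triangles are labelled -/
  side_lab : ∀ t ∈ s.tris.toList, ∀ a ∈ tset t, ∀ b ∈ tset t, a ≠ b → s.gdom a b ≠ UNL

/-! ### Part C. Auxiliary sets, relabelling, root normalisation -/

/-- The set of `M`-triangles through two labels. [folklore] -/
def KConf.onSide (M : KConf) (v x : ℕ) : Finset (Finset ℕ) := M.T.filter fun t => v ∈ t ∧ x ∈ t

/-- The placed triangles through two labels. [folklore] -/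
def St.onSideL (s : St) (v x : ℕ) : List ℕ := s.tris.toList.filter fun t => tmem t v && tmem t x

/-- The sides of the triangles of `M` (two-element subsets). [folklore] -/
def KConf.sides (M : KConf) : Finset (Finset ℕ) := M.T.biUnion fun t => t.powersetCard 2

/-- The long sides (not contacts). [folklore] -/
noncomputable def KConf.longSides (M : KConf) : Finset (Finset ℕ) := M.sides.filter fun e => ∃ p ∈ e, ∃ q ∈ e, p ≠ q ∧ M.g p q ≠ 1 / 2

/-- The type of a pair in `M`: `0` for a contact, `1` otherwise. [folklore] -/
noncomputable def KConf.ty (M : KConf) (p q : ℕ) : ℕ := if M.g p q = 1 / 2 then 0 else 1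

/-- **The root normalisation** carried along the search: label `0` has exactly four contacts,
at most one long side of the triangulation, and the reflection tie-break
`(ty 0 3, ty 1 3) ≤ (ty 0 4, ty 2 4)` holds. [folklore] -/
def KConf.RootInv (M : KConf) : Prop :=
  ((Finset.range 12).filter fun u => u ≠ 0 ∧ M.g 0 u = 1 / 2).card = 4 ∧
  (∀ u w, ({0, u} : Finset ℕ) ∈ M.longSides → ({0, w} : Finset ℕ) ∈ M.longSides → u = w) ∧
  ¬ (M.ty 0 4 < M.ty 0 3 ∨ (M.ty 0 3 = M.ty 0 4 ∧ M.ty 2 4 < M.ty 1 3))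

/-- The true code of a pair: its present code if labelled, else contact or the full long range
according to `M`. [folklore] -/
noncomputable def trueCode (M : KConf) (s : St) (p q : ℕ) : ℕ :=
  if s.gdom p q ≠ UNL then s.gdom p q else if M.g p q = 1 / 2 then 0 else FULLR

/-- The contacts of a label. [folklore] -/
noncomputable def KConf.contacts (M : KConf) (v : ℕ) : Finset ℕ := (Finset.range 12).filter fun u => u ≠ v ∧ M.g v u = 1 / 2

/-- The long sides through a label (as the other endpoint). [folklore] -/
noncomputable def KConf.longSpokes (M : KConf) (v : ℕ) : Finset ℕ := (Finset.range 12).filter fun u => ({v, u} : Finset ℕ) ∈ M.longSides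

/-- **The good configuration at a root vertex**: the root `v₀`, a triangle `{v₀, p, q}` with two
contact spokes, and the further triangles `{v₀, p, p₃}`, `{v₀, q, p₄}` (`p₃ ≠ p₄`), with the
four-contacts and one-long-side conditions at `v₀`. [folklore] -/
def KConf.Good (M : KConf) (v₀ p q p₃ p₄ : ℕ) : Prop :=
  v₀ < 12 ∧ p < 12 ∧ q < 12 ∧ p₃ < 12 ∧ p₄ < 12 ∧
  v₀ ≠ p ∧ v₀ ≠ q ∧ v₀ ≠ p₃ ∧ v₀ ≠ p₄ ∧ p ≠ q ∧ p ≠ p₃ ∧ p ≠ p₄ ∧ q ≠ p₃ ∧ q ≠ p₄ ∧ p₃ ≠ p₄ ∧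
  M.g v₀ p = 1 / 2 ∧ M.g v₀ q = 1 / 2 ∧
  ({v₀, p, q} : Finset ℕ) ∈ M.T ∧ ({v₀, p, p₃} : Finset ℕ) ∈ M.T ∧ ({v₀, q, p₄} : Finset ℕ) ∈ M.T ∧
  (M.contacts v₀).card = 4 ∧ (∀ u w, ({v₀, u} : Finset ℕ) ∈ M.longSides → ({v₀, w} : Finset ℕ) ∈ M.longSides → u = w)

/-- The root domains by side index (specification of `mkRoot`). [folklore] -/
def rootDomIdx (m bits i : ℕ) : ℕ :=
  let lab : ℕ → ℕ := fun t => if t = 0 then 0 else FULLR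
  if i = sIdx 0 1 then 0 else if i = sIdx 0 2 then 0 else if i = sIdx 1 2 then lab m
  else if i = sIdx 0 3 then lab (bits % 2) else if i = sIdx 1 3 then lab ((bits / 2) % 2)
  else if i = sIdx 0 4 then lab ((bits / 4) % 2) else if i = sIdx 2 4 then lab ((bits / 8) % 2) else UNL

/-- The type bits read off `M`. [folklore] -/
noncomputable def bitsOf (M : KConf) : ℕ := M.ty 0 3 + 2 * M.ty 1 3 + 4 * M.ty 0 4 + 8 * M.ty 2 4

/-! #### Relabelling -/

section Relabel

variable (M : KConf) (σ : Equiv.Perm ℕ) (hσ : ∀ a, σ a < 12 ↔ a < 12)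

/-- Image of a label set under the permutation. [folklore] -/
def relab (σ : Equiv.Perm ℕ) (t : Finset ℕ) : Finset ℕ := t.image σ

/-- `relab` by `σ⁻¹` undoes `relab` by `σ`. [folklore] -/
theorem relab_symm_relab (t : Finset ℕ) : relab σ.symm (relab σ t) = t := by
  unfold relab; rw [Finset.image_image]; simp

/-- `relab` by `σ` undoes `relab` by `σ⁻¹`. [folklore] -/
theorem relab_relab_symm (t : Finset ℕ) : relab σ (relab σ.symm t) = t := by
  unfold relab; rw [Finset.image_image]; simp

/-- `relab` is injective. [folklore] -/
theorem relab_injective : Function.Injective (relab σ) := fun t t' h => by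
  have := congrArg (relab σ.symm) h
  rwa [relab_symm_relab, relab_symm_relab] at this

/-- Membership in a relabelled set. [folklore] -/
theorem mem_relab_iff {t : Finset ℕ} {a : ℕ} : a ∈ relab σ t ↔ σ.symm a ∈ t := by
  unfold relab
  rw [Finset.mem_image]
  constructor
  · rintro ⟨b, hb, rfl⟩; simpa using hb
  · intro h; exact ⟨σ.symm a, h, by simp⟩

end Relabel
end KissingSearch
end Summit.Ventures.Crystal3D.Kissing125
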